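import Summits.NavierStokesRegularity.FluidComputer.PalasekTowerClayBridge

/-!
# A realisation with a silent tail is an UNFORCED finite-time loss of smoothness after the silence

Cell `ns-blowup`, seat `ns-blowup-ecbridge-1` (g2); companion of `PalasekTowerClayBridge.lean`
(p403760: `Realisation`) and `PalasekTowerReforce.lean` (p406876: schedule-universal heredity over
a re-forcing-closed class yields a realisation whose force is SILENT from some `b < T`). LABEL: E-C
typing (kernel bookkeeping in the tree's continuation vocabulary); WHAT THIS IS NOT: not Navier–Stokes
evidence — no realisation is constructed; the file says what a silent-tailed one IS.

Planner ADDENDUM l.1015 (1) records that the route of record's items (`EpisodeBaseR`,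
`EpisodeInductionR`) assert AUTONOMOUS heredity, hence (p406876, companion
`PalasekTowerDepthRegister`) a realisation `W` with `W.f ≡ 0` on `[b, ∞)` for some `b < W.T`, and that
this «does assert an unforced Type-II cascade on `(b, T)`» while the state `u(b)` is smooth and of
finite energy but not a Clay datum (no rapid decay is claimed). This file makes the first half a
theorem in the vocabulary of `Literature.Analysis.FluidPDE.IsClassicalNSSolutionOn` /
`HasSmoothExtensionPast`: from time `b` on, `(W.u, W.p)` is a classical solution of the UNFORCED
system on `[b, T)` (`Realisation.unforced_after`), its state at `b` is `C^∞` with finite energy and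
divergence free, and NO classical solution of the unforced system on any `[b, T')`, `T' > T`, agrees
with `W.u` on `[b, T)` (`Realisation.no_unforced_extension_after`: joint continuity on the compact box
`[b, T] × B̄(0, radius)` against the divergent floors at the readout times `τ k ↑ T`, which enter
`[b, T)` eventually) — `Realisation.unforced_blowup_after`. So the items of record assert a
finite-energy smooth (non-decaying-class) UNFORCED blow-up; the unforced catalogue
(`Literature.Barriers.NavierStokesRegularity.*`, KILLSHEET XX.5) applies to the tail verbatim.

References: S. Palasek, arXiv:2605.13827 §4, Rem. 1.4 [cite: Palasek2026ElementaryModel, §4];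
J. T. Beale, T. Kato, A. Majda, Comm. Math. Phys. 94 (1984) §1 [cite: BealeKatoMajda1984, §1].
-/

noncomputable section

namespace Summit.NavierStokesRegularity.FluidComputer.PalasekTowerClayBridge

open Set MeasureTheory Filter Topology Function
open scoped ENNReal ContDiff NNReal
open Literature.Analysis.FluidPDE

namespace Realisation

variable {ν : ℝ} {R : TowerRates} (W : Realisation ν R)

/-- **After the silence the tower solves the UNFORCED system**: if `W.f ≡ 0` on `[b, ∞)` (`0 ≤ b`),
then `(W.u, W.p)` is a classical solution of the unforced Navier–Stokes system on `[b, T) × ℝ³`.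
[folklore] -/
theorem unforced_after {b : ℝ} (hb : 0 ≤ b) (hf : ∀ t, b ≤ t → ∀ x, W.f t x = 0) :
    IsClassicalNSSolutionOn (Ico b W.T) ν 0 W.u W.p := by
  have hsub : Ico b W.T ⊆ Ico 0 W.T := fun t ht => ⟨le_trans hb ht.1, ht.2⟩
  have hcl := W.classical.mono hsub (uniqueDiffOn_Ico b W.T)
  refine ⟨hcl.smooth_velocity, hcl.smooth_pressure, ?_, hcl.divFree⟩
  intro t ht x
  have hmom := hcl.momentum t ht x
  rw [hf t ht.1 x] at hmom
  simpa using hmom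

/-- The readout times enter every final segment `[b, T)`: for `b < T`, eventually `b ≤ τ (k+1)`
(the clock `T - τ (k+1) ≤ c₃ / A_k` with `A_k → ∞`). [folklore] -/
theorem eventually_le_τ {b : ℝ} (hbT : b < W.T) : ∀ᶠ k in atTop, b ≤ W.τ (k + 1) := by
  have hA : Tendsto R.A atTop atTop := by
    have hβ : 0 < R.β := by linarith [R.two_lt_β]
    exact (tendsto_rpow_atTop hβ).comp R.tendsto_N_atTop
  have h0 : Tendsto (fun k => W.c₃ / R.A k) atTop (𝓝 0) := tendsto_const_nhds.div_atTop hA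
  have hev : ∀ᶠ k in atTop, W.c₃ / R.A k < W.T - b := (tendsto_order.1 h0).2 _ (by linarith)
  filter_upwards [hev] with k hk
  have := W.clock k
  linarith

/-- **No unforced classical continuation past `T` from time `b`.** A classical solution of the
unforced system on `[b, T') × ℝ³`, `T' > T`, agreeing with `W.u` on `[b, T)` would be jointly
continuous on the compact box `[b, T] × B̄(0, radius)`, hence bounded there — but the floors
`c₁ Y_k → ∞` are attained at the points `(τ k, x_k)` of that box for all large `k`. (The forcing of the
would-be continuation plays no role: only its joint smoothness is used.) [cite: BealeKatoMajda1984, §1] -/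
theorem no_extension_after {b : ℝ} (hbT : b < W.T) {T' : ℝ} (hT' : W.T < T')
    {g : ℝ → EuclideanSpace ℝ (Fin 3) → EuclideanSpace ℝ (Fin 3)} {μ : ℝ}
    {u' : ℝ → EuclideanSpace ℝ (Fin 3) → EuclideanSpace ℝ (Fin 3)}
    {p' : ℝ → EuclideanSpace ℝ (Fin 3) → ℝ} (hcl' : IsClassicalNSSolutionOn (Ico b T') μ g u' p')
    (heq : ∀ t ∈ Ico b W.T, u' t = W.u t) : False := by
  set K : Set (ℝ × EuclideanSpace ℝ (Fin 3)) :=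
    Icc b W.T ×ˢ Metric.closedBall (0 : EuclideanSpace ℝ (Fin 3)) W.radius with hKdef
  have hK : IsCompact K := isCompact_Icc.prod (isCompact_closedBall _ _)
  have hsub : K ⊆ Ico b T' ×ˢ (univ : Set (EuclideanSpace ℝ (Fin 3))) :=
    prod_mono (fun s hs => ⟨hs.1, lt_of_le_of_lt hs.2 hT'⟩) (subset_univ _)
  have hcont : ContinuousOn (uncurry u') K :=
    (ContDiffOn.continuousOn hcl'.smooth_velocity).mono hsub
  obtain ⟨M, hM⟩ := hK.exists_bound_of_continuousOn hcont
  -- pick a late level: its readout time is in `[b, T)` and its floor beats `M`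
  have hc₁ : 0 < W.c₁ := W.c₁_pos
  have hevY : ∀ᶠ k in atTop, M / W.c₁ + 1 ≤ R.Y (k + 1) :=
    (R.tendsto_Y_atTop.comp (tendsto_add_atTop_nat 1)).eventually
      (eventually_ge_atTop (M / W.c₁ + 1))
  obtain ⟨k, hkY, hkτ⟩ := (hevY.and (W.eventually_le_τ hbT)).exists
  obtain ⟨x, hxR, hfloor⟩ := W.floor (k + 1)
  have hτ : W.τ (k + 1) ∈ Ico b W.T := ⟨hkτ, (W.τ_mem (k + 1)).2⟩
  have hxK : x ∈ Metric.closedBall (0 : EuclideanSpace ℝ (Fin 3)) W.radius := by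
    rw [Metric.mem_closedBall, dist_zero_right]
    exact hxR
  have hmem : (W.τ (k + 1), x) ∈ K := mk_mem_prod ⟨hτ.1, hτ.2.le⟩ hxK
  have hbound := hM _ hmem
  have hvk : u' (W.τ (k + 1)) = W.u (W.τ (k + 1)) := heq _ hτ
  simp only [Function.uncurry_apply_pair, hvk] at hbound
  have h3 : M / W.c₁ < R.Y (k + 1) := by linarith
  have h4 : M < R.Y (k + 1) * W.c₁ := (div_lt_iff₀ hc₁).1 h3
  have h5 : M < W.c₁ * R.Y (k + 1) := by rwa [mul_comm] at h4
  linarith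

/-- **Silent tail ⇒ UNFORCED finite-time loss of smoothness from a smooth finite-energy state.** If
the force of a realisation vanishes identically from a time `b ∈ [0, T)` on, then: `(W.u, W.p)` is a
classical solution of the unforced system on `[b, T)`; the state `W.u b` is `C^∞`, divergence free and
of finite energy (it is NOT claimed to be a Clay datum — no rapid decay); and no classical solution of
the unforced system on any `[b, T')`, `T' > T`, continues it. With `realisation_silent_of_episodesR`
(companion `PalasekTowerDepthRegister`): the route of record's items assert such an object.
[cite: Palasek2026ElementaryModel, §4 and Rem. 1.4] [cite: BealeKatoMajda1984, §1] -/
theorem unforced_blowup_after {b : ℝ} (hb : 0 ≤ b) (hbT : b < W.T)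
    (hf : ∀ t, b ≤ t → ∀ x, W.f t x = 0) :
    IsClassicalNSSolutionOn (Ico b W.T) ν 0 W.u W.p ∧
      ContDiff ℝ ∞ (W.u b) ∧ NSWave0.IsDivFree (W.u b) ∧
      (∃ C : ℝ≥0∞, C < ⊤ ∧ ∫⁻ x, ‖W.u b x‖ₑ ^ 2 ≤ C) ∧
      ∀ T', W.T < T' →
        ¬ ∃ (u' : ℝ → EuclideanSpace ℝ (Fin 3) → EuclideanSpace ℝ (Fin 3))
            (p' : ℝ → EuclideanSpace ℝ (Fin 3) → ℝ),
            IsClassicalNSSolutionOn (Ico b T') ν 0 u' p' ∧ ∀ t ∈ Ico b W.T, u' t = W.u t := by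
  refine ⟨W.unforced_after hb hf, W.classical.contDiff_velocity ⟨hb, hbT⟩,
    W.classical.divFree b ⟨hb, hbT⟩, ?_, ?_⟩
  · obtain ⟨C, hC, hE⟩ := W.energy b hbT
    exact ⟨C, hC, hE b ⟨hb, le_rfl⟩⟩
  · rintro T' hT' ⟨u', p', hcl', heq⟩
    exact W.no_extension_after hbT hT' hcl' heq

end Realisation

end Summit.NavierStokesRegularity.FluidComputer.PalasekTowerClayBridge

end
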